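import Summits.CriticalPhenomena.PercolationContinuityZ3.Theorems.Transplant.FKConnectivityAllQWagner
import Summits.CriticalPhenomena.PercolationContinuityZ3.Theorems.Transplant.FKConnectivityAllQHubCovFiberPoly
import HarnessLib

/-!
# Connectivity correlation inequalities for `φ_{w,q}`, every `q > 0` — REDUCTION: rows proved on 2-TREE supports hold on every `K₄`-MINOR-FREE SUPPORT

Proof file (`--supports stmt-CriticalPhenomena-4575`), census lineage (gen 38) of LANE 2's FK sub-programme; builds on p205010
(kernel theorem, internal audit signed; external expert review pending).  No definitions, no named facts, no sorries.

A reusable reduction for three-point rows of `φ_{w,q}`: if a row (here the hub inequality `FK.HubUnder`, ALR (13)/(14), and the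
sharper correlation `φ(s ↔ t)·φ(b ↔ {s,t}) ≤ φ(Ω)·φ(s ↔ t, b ↔ {s,t})`) holds at every triple for EVERY weight vector supported on the
pairs of a 2-tree (`FK.IsTwoTree`), then it holds at every triple for every weight vector whose SUPPORT GRAPH has no `K₄` minor — by
fk-3's structure theorem `FK.exists_isTwoTree_superset_of_not_hasK4Minor` (`K₄`-minor-free graphs are partial 2-trees; Dirac 1952 /
Duffin 1965 / Wald–Colbourn 1983) after loop erasure (`FK.rcMeasureW_real_eraseLoops`: the support graph `SimpleGraph.fromEdgeSet`
ignores diagonal pairs and connection events ignore loops; `|V| ≤ 1` is the fully degenerate triple).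
* `FK.hubUnder_eraseLoops_iff`, `FK.real_conn_union_le_eraseLoops_iff` — the rows for `φ_w` are the rows for `φ_{w°}` (loops zeroed);
* `FK.hubUnder_self` — the fully degenerate triple;
* **`FK.hubUnder_of_noK4Minor_of_twoTree`**, **`FK.real_conn_union_le_of_noK4Minor_of_twoTree`** — the reductions.
Consumer: census g37's `FK.hubUnder_of_isTwoTree_support` (`…Pat3DeltaSP.lean`, THEOREM SP on minors) gives the hypothesis, whence the
hub inequality at every triple on every series–parallel support, every `q > 0` (`…Pat3NoK4Minor.lean`).
[cite: Diestel2017, §7.3 (Prop. 7.3.1, Cor. 7.3.2)] [cite: Grimmett2006, §1.4 eq. (1.20) (p. 15); §3.9 (p. 63)]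
[cite: AyyerLinussonRavichandran2025, §7 eq. (13)–(15) (p. 22)]
-/

noncomputable section

namespace Summit.CriticalPhenomena.PercolationContinuityZ3.Theorems

namespace FK

open MeasureTheory Set Literature.Probability.LatticeModels Literature.Probability.Percolation
open scoped Classical symmDiff

variable {V : Type*} [Fintype V] (w : Sym2 V → unitInterval)

/-! ### Loop erasure for the two rows -/

/-- **Loop erasure for the hub inequality** (`0 < q`): with `w° e = 0` on diagonal pairs and `w° e = w e` otherwise,
`HubUnder φ_w o a b ↔ HubUnder φ_{w°} o a b` (the three events of the row are connection events, insensitive to loops).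
[cite: Grimmett2006, §1.4 eq. (1.20) (p. 15)] -/
theorem hubUnder_eraseLoops_iff {q : ℝ} (hq : 0 < q) (o a b : V) :
    HubUnder (rcMeasureW w q ∅) o a b ↔
      HubUnder (rcMeasureW (fun e => if e.IsDiag then (0 : unitInterval) else w e) q ∅) o a b := by
  unfold HubUnder
  have hI : ∀ v : V, ∀ ω : BondConfig V, ω ∆ {s(v, v)} ∈ (openConn o a ∩ openConn b a : Set (BondConfig V)) ↔
      ω ∈ (openConn o a ∩ openConn b a : Set (BondConfig V)) := fun v ω => by
    simp only [Set.mem_inter_iff, openConn_symmDiff_loop]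
  have hU : ∀ v : V, ∀ ω : BondConfig V, ω ∆ {s(v, v)} ∈ (Set.univ : Set (BondConfig V)) ↔
      ω ∈ (Set.univ : Set (BondConfig V)) := fun v ω => by simp only [Set.mem_univ]
  rw [rcMeasureW_real_eraseLoops w hq _ (openConn_symmDiff_loop o a), rcMeasureW_real_eraseLoops w hq _ (openConn_symmDiff_loop b a),
    rcMeasureW_real_eraseLoops w hq _ hI, rcMeasureW_real_eraseLoops w hq _ hU]

/-- **Loop erasure for the sharper correlation** (`0 < q`): the inequality for `φ_w` is the inequality for `φ_{w°}`.
[cite: Grimmett2006, §1.4 eq. (1.20) (p. 15)] -/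
theorem real_conn_union_le_eraseLoops_iff {q : ℝ} (hq : 0 < q) (b s t : V) :
    (rcMeasureW w q ∅).real (openConn s t) * (rcMeasureW w q ∅).real (openConn b s ∪ openConn b t) ≤
      (rcMeasureW w q ∅).real univ * (rcMeasureW w q ∅).real (openConn s t ∩ (openConn b s ∪ openConn b t)) ↔
    (rcMeasureW (fun e => if e.IsDiag then (0 : unitInterval) else w e) q ∅).real (openConn s t) *
        (rcMeasureW (fun e => if e.IsDiag then (0 : unitInterval) else w e) q ∅).real (openConn b s ∪ openConn b t) ≤
      (rcMeasureW (fun e => if e.IsDiag then (0 : unitInterval) else w e) q ∅).real univ *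
        (rcMeasureW (fun e => if e.IsDiag then (0 : unitInterval) else w e) q ∅).real
          (openConn s t ∩ (openConn b s ∪ openConn b t)) := by
  have hUn : ∀ v : V, ∀ ω : BondConfig V, ω ∆ {s(v, v)} ∈ (openConn b s ∪ openConn b t : Set (BondConfig V)) ↔
      ω ∈ (openConn b s ∪ openConn b t : Set (BondConfig V)) := fun v ω => by
    simp only [Set.mem_union, openConn_symmDiff_loop]
  have hI : ∀ v : V, ∀ ω : BondConfig V, ω ∆ {s(v, v)} ∈ (openConn s t ∩ (openConn b s ∪ openConn b t) : Set (BondConfig V)) ↔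
      ω ∈ (openConn s t ∩ (openConn b s ∪ openConn b t) : Set (BondConfig V)) := fun v ω => by
    simp only [Set.mem_inter_iff, Set.mem_union, openConn_symmDiff_loop]
  have hU : ∀ v : V, ∀ ω : BondConfig V, ω ∆ {s(v, v)} ∈ (Set.univ : Set (BondConfig V)) ↔
      ω ∈ (Set.univ : Set (BondConfig V)) := fun v ω => by simp only [Set.mem_univ]
  rw [rcMeasureW_real_eraseLoops w hq _ (openConn_symmDiff_loop s t), rcMeasureW_real_eraseLoops w hq _ hUn,
    rcMeasureW_real_eraseLoops w hq _ hI, rcMeasureW_real_eraseLoops w hq _ hU]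

omit [Fintype V] in
/-- The hub inequality at a fully degenerate triple `o = a = b` is `μ(Ω)·μ(Ω) ≤ μ(Ω)·μ(Ω)`. [folklore] -/
theorem hubUnder_self (μ : Measure (BondConfig V)) (a : V) : HubUnder μ a a a := by
  unfold HubUnder
  have huniv : (openConn a a : Set (BondConfig V)) = Set.univ := Set.compl_empty_iff.1 (compl_openConn_self a)
  rw [huniv, Set.inter_self]

/-! ### The reductions -/

omit [Fintype V] in
/-- Every nondiagonal pair in the support of `w°` (loops zeroed) is an edge of the support graph of `w`, hence lies in any 2-tree
containing that graph. [folklore] -/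
theorem mem_of_support_eraseLoops {T : Set (Sym2 V)}
    (hTE : ∀ a b : V, (SimpleGraph.fromEdgeSet {e : Sym2 V | ((w e : unitInterval) : ℝ) ≠ 0}).Adj a b → s(a, b) ∈ T)
    (g : Sym2 V) (hg : (((fun e => if e.IsDiag then (0 : unitInterval) else w e) g : unitInterval) : ℝ) ≠ 0) : g ∈ T := by
  by_cases hgd : g.IsDiag
  · exact (hg (by simp only [if_pos hgd]; rfl)).elim
  · simp only [if_neg hgd] at hg
    induction g using Sym2.ind with
    | h x y => exact hTE x y ((SimpleGraph.fromEdgeSet_adj _).2 ⟨hg, fun h => hgd (Sym2.mk_isDiag_iff.2 h)⟩)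

/-- **REDUCTION for the hub inequality**: if `HubUnder φ_{w',q} o a b` holds at every triple for every weight vector `w'` supported on the
pairs of a 2-tree, then it holds at every triple for every `w` whose support graph has no `K₄` minor (`K₄`-minor-free graphs are partial
2-trees; loops erased; `|V| ≤ 1` degenerate). [cite: Diestel2017, §7.3 (Prop. 7.3.1, Cor. 7.3.2)] [cite: Grimmett2006, §3.9 (p. 63)] -/
theorem hubUnder_of_noK4Minor_of_twoTree {q : ℝ} (hq : 0 < q)
    (H : ∀ T : Set (Sym2 V), IsTwoTree T → ∀ w' : Sym2 V → unitInterval,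
      (∀ e, ((w' e : unitInterval) : ℝ) ≠ 0 → e ∈ T) → ∀ o a b : V, HubUnder (rcMeasureW w' q ∅) o a b)
    (hK : ¬ HasK4Minor (SimpleGraph.fromEdgeSet {e : Sym2 V | ((w e : unitInterval) : ℝ) ≠ 0})) (o a b : V) :
    HubUnder (rcMeasureW w q ∅) o a b := by
  rw [hubUnder_eraseLoops_iff w hq]
  by_cases hV : 1 < Fintype.card V
  · obtain ⟨T, hT, hTE⟩ := exists_isTwoTree_superset_of_not_hasK4Minor _ hK hV
    exact H T hT _ (mem_of_support_eraseLoops w hTE) o a b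
  · have h1 : Fintype.card V ≤ 1 := not_lt.1 hV
    rw [Fintype.card_le_one_iff.1 h1 o a, Fintype.card_le_one_iff.1 h1 b a]
    exact hubUnder_self _ a

/-- **REDUCTION for the sharper correlation** `φ(s ↔ t)·φ(b ↔ {s,t}) ≤ φ(Ω)·φ(s ↔ t, b ↔ {s,t})`: 2-tree supports suffice for every
`K₄`-minor-free support. [cite: Diestel2017, §7.3 (Prop. 7.3.1, Cor. 7.3.2)] [cite: AyyerLinussonRavichandran2025, §7 (p. 22)] -/
theorem real_conn_union_le_of_noK4Minor_of_twoTree {q : ℝ} (hq : 0 < q)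
    (H : ∀ T : Set (Sym2 V), IsTwoTree T → ∀ w' : Sym2 V → unitInterval,
      (∀ e, ((w' e : unitInterval) : ℝ) ≠ 0 → e ∈ T) → ∀ b s t : V,
        (rcMeasureW w' q ∅).real (openConn s t) * (rcMeasureW w' q ∅).real (openConn b s ∪ openConn b t) ≤
          (rcMeasureW w' q ∅).real univ * (rcMeasureW w' q ∅).real (openConn s t ∩ (openConn b s ∪ openConn b t)))
    (hK : ¬ HasK4Minor (SimpleGraph.fromEdgeSet {e : Sym2 V | ((w e : unitInterval) : ℝ) ≠ 0})) (b s t : V) :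
    (rcMeasureW w q ∅).real (openConn s t) * (rcMeasureW w q ∅).real (openConn b s ∪ openConn b t) ≤
      (rcMeasureW w q ∅).real univ * (rcMeasureW w q ∅).real (openConn s t ∩ (openConn b s ∪ openConn b t)) := by
  rw [real_conn_union_le_eraseLoops_iff w hq]
  by_cases hV : 1 < Fintype.card V
  · obtain ⟨T, hT, hTE⟩ := exists_isTwoTree_superset_of_not_hasK4Minor _ hK hV
    exact H T hT _ (mem_of_support_eraseLoops w hTE) b s t
  · have h1 : Fintype.card V ≤ 1 := not_lt.1 hV
    have huniv : (openConn s s : Set (BondConfig V)) = Set.univ := Set.compl_empty_iff.1 (compl_openConn_self s)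
    rw [Fintype.card_le_one_iff.1 h1 b s, Fintype.card_le_one_iff.1 h1 t s, huniv, Set.union_self, Set.inter_self]

end FK

end Summit.CriticalPhenomena.PercolationContinuityZ3.Theorems

end
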